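import Summits.QuantumFields.BalabanUV.T4Continuum.Support.NE7LocalStraightDatumLetter
import Summits.QuantumFields.BalabanUV.T4Continuum.Support.NE3QbarIterCovLiftPrep
import Summits.QuantumFields.BalabanUV.T4Continuum.Support.AveragingDeficitLatticeH2Prep
import HarnessLib

/-!
# NE7CurvedSupLetterPrep — THE STRAIGHT DATUM OF THE CUT-OFF GAUGED SLICE ELEMENT IN CLOSED FORM: with the lattice cut-off `χ = chi R M′ y₀` (`1∕M′`-Lipschitz per sup-unit step) and the
# comb gauge `u`, `‖QbarIter L (k+1) 1 (χ•Y^u) zc κ‖ ≤ M·S·(2(M−1)∕M′ + (2∕L)·((2d+4)L²·Mδ + (2(2d+4)L² + 8L + C_sup)·(68∕3)(d+1)(d+4)·M²x))` from `‖W^u − 1‖ ≤ δ` on the fine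
# ball of `zc` — NE7b's (C2) letter with row NE3's CLOSED near-identity tower and the k-free level sums (`M = L^{k+1}`)

Cell `pub-balaban`, rung (B)+1 sub-cell t4, lineage `b2b-balaban-t4-ne7-p1`, generation 101 (CRUX PROVER NE7 #1 = OWNER of BINDER row NE7).  Memo
`t4/b2b-balaban-t4-ne7-p1-g101/ROAD-G101.md` §5 (prep of the assembly (E2) of THE CURVED SUP LETTER (L)).  The NE7b seat's `NE7LocalStraightDatumLetter` (asked by name, INBOX
L.2493∕[NE7bP1-G150-INBOX-9]) states the curved half with the OPEN near-identity family `δ_i = L^iδ + 4Σ_{i′<i}L^{i−1−i′}loopRad(x_{i′})` of `norm_cavgIter_sub_one_le_tower`; the assembly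
wants a k-FREE number.  THIS FILE re-threads the same three steps (cut-off commutator `cutoff_commutator_flat`, covariance `QbarIter_gaugeAct`, tower `norm_QbarIter_sub_linQIter_le`) through
row NE3's CLOSED family `δ_i = L^iδ + 2·loopRad(x_i)` (`NE3QbarIterCovLiftPrep.norm_cavgIter_sub_one_le_closed`) and sums the levels with a FREE fine-bond radius `δ`
(`sum_rho_le_of_delta`: `Σ_{i<k+1}((2d+4)L²·δ_i + (8L + C_sup)loopRad(x_i)) ≤ (2d+4)L²·M·δ + (2(2d+4)L² + 8L + C_sup)·(4∕3)·17(d+1)(d+4)·M²x`, by `sum_pow_le_pow_real`,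
`sum_loopRad_iterate_le`, `loopRad_iterate_le_of_levelSmall`).
WHAT ([folklore]; 0 def, 0 sorry; every `d`, `L ≥ 2`, multi-level small-field class at `W`).  §1 `sum_rho_le_of_delta`.  §2 **`straight_datum_closed`** (fine-ball hypothesis at `zc`, sup-step
Lipschitz cut-off with constant `g`, `|χ| ≤ 1`), `straight_datum_off_support` (`χ = 0` on the straight-average region ⟹ the datum vanishes; = NE7b's `local_straight_datum_letter_off_support`
with `ω = 0`).
HONEST FRAMING (page 1): bookkeeping BY NAME over the NE7b seat's (C2) letter and row NE3's tower letters; nothing of Bałaban's asserted; THE CURVED LETTER (L) IS NOT PROVED HERE; NOT (S1),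
NOT NE7; spine 0∕9; finite T⁴ rung (B)+1 — NOT infinite volume, NOT mass gap, NOT BetaPertH, NOT Clay.  Continuum YM on T⁴ ⇐ BetaPertH ∧ nine spine estimates (0/9 proved); BetaPertH ⇐
(D1) ∧ (D4) ∧ CAP+tail; G-an2-4 gates asym, D1 and NE2/3/4.
-/

set_option autoImplicit false

open scoped BigOperators Matrix.Norms.L2Operator
open Finset

namespace Summit.QuantumFields.BalabanUV.T4Continuum.NE7CurvedSupLetterPrep

open Literature.MathematicalPhysics.QuantumFieldTheory.Balaban1983to89
open B7Prop1Explicit B7Prop2Explicit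
open B7Prop4Flat (linQIter)
open T4AveragingDeficitWall (IsUnitaryCfg SmallField Ad)
open AveragingDeficitNearIdentity (Ad_zero)
open AveragingDeficitMultiLevelPrep (LevelSmall)
open AveragingDeficitTwoLevelPrep (prop1Radius)
open SpreadLift (loopRad)
open BlockAverageVaryHolo (nbRad)
open BlockAveragePushDirSplit (flat)
open NE3TangentCovariantTower (QbarIter)
open NE3CovariantLineSumsError (Csup Csup_nonneg iterate_prop1Radius_nonneg)
open NE3QbarIterNearFlat (norm_QbarIter_sub_linQIter_le norm_QbarIter_le_two_mul)
open NE3QbarIterCovLiftPrep (norm_cavgIter_sub_one_le_closed sum_pow_le_pow_real sum_loopRad_iterate_le)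
open NE3TopRadiusLetters (loopRad_iterate_le_of_levelSmall)
open NE3QbarGaugeCovariance (QbarIter_gaugeAct)
open SpreadLiftDirection (isUnitaryCfg_gaugeAct')
open BlockAverageCurrent (smallField_gaugeAct)
open NE7LocalStraightDatumLetter (cutoff_commutator_flat linQIter_eq_QbarIter_flat norm_dirGauge_le osc_region_of_supStep local_straight_datum_letter_off_support)

noncomputable section

variable {d : ℕ} {n : Type*} [Fintype n] [DecidableEq n]

/-! ## §1 The k-free level sum with a free fine-bond radius -/

omit [Fintype n] [DecidableEq n] in
/-- **THE LEVEL SUM WITH A FREE FINE-BOND RADIUS** (`L ≥ 2`, class `LevelSmall d L k x`, `δ ≥ 0`; `M = L^{k+1}`): with `δ_i = L^i·δ + 2·loopRad(x_i)`,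
`Σ_{i<k+1} ((2d+4)L²·δ_i + (8L + C_sup)·loopRad(x_i)) ≤ (2d+4)L²·M·δ + (2(2d+4)L² + 8L + C_sup)·(4∕3)·(17(d+1)(d+4))·M²x`. [folklore] -/
theorem sum_rho_le_of_delta {L : ℕ} (hL : 2 ≤ L) (k : ℕ) {x : ℝ} (hx : 0 ≤ x) (hs : LevelSmall d L k x) {δ : ℝ} (hδ : 0 ≤ δ) :
    (∑ i ∈ Finset.range (k + 1), ((2 * (d : ℝ) + 4) * (L : ℝ) ^ 2 * ((L : ℝ) ^ i * δ + 2 * loopRad d L ((prop1Radius d L)^[i] x))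
        + (8 * (L : ℝ) + Csup d L) * loopRad d L ((prop1Radius d L)^[i] x)))
      ≤ (2 * (d : ℝ) + 4) * (L : ℝ) ^ 2 * ((L : ℝ) ^ (k + 1) * δ)
        + (2 * ((2 * (d : ℝ) + 4) * (L : ℝ) ^ 2) + (8 * (L : ℝ) + Csup d L)) * (4 / 3 * (17 * (((d : ℝ) + 1) * ((d : ℝ) + 4)) * (((L : ℝ) ^ (k + 1)) ^ 2 * x))) := by
  set A : ℝ := (2 * (d : ℝ) + 4) * (L : ℝ) ^ 2 with hA
  set Bc : ℝ := 8 * (L : ℝ) + Csup d L with hB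
  have hA0 : 0 ≤ A := by rw [hA]; positivity
  have hB0 : 0 ≤ Bc := by rw [hB]; have := Csup_nonneg d L; positivity
  have hsplit : (∑ i ∈ Finset.range (k + 1), (A * ((L : ℝ) ^ i * δ + 2 * loopRad d L ((prop1Radius d L)^[i] x)) + Bc * loopRad d L ((prop1Radius d L)^[i] x)))
      = A * δ * (∑ i ∈ Finset.range (k + 1), (L : ℝ) ^ i) + (2 * A + Bc) * (∑ i ∈ Finset.range (k + 1), loopRad d L ((prop1Radius d L)^[i] x)) := by
    rw [Finset.mul_sum, Finset.mul_sum, ← Finset.sum_add_distrib]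
    exact Finset.sum_congr rfl fun i _ => by ring
  rw [hsplit]
  have hgeo := sum_pow_le_pow_real hL (k + 1)
  have hlr := sum_loopRad_iterate_le (d := d) hL hx k
  have htop := loopRad_iterate_le_of_levelSmall (d := d) hL k hx hs
  have h1 : A * δ * (∑ i ∈ Finset.range (k + 1), (L : ℝ) ^ i) ≤ A * δ * (L : ℝ) ^ (k + 1) := mul_le_mul_of_nonneg_left hgeo (by positivity)
  have h2 : (2 * A + Bc) * (∑ i ∈ Finset.range (k + 1), loopRad d L ((prop1Radius d L)^[i] x))
      ≤ (2 * A + Bc) * (4 / 3 * (17 * (((d : ℝ) + 1) * ((d : ℝ) + 4)) * (((L : ℝ) ^ (k + 1)) ^ 2 * x))) := by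
    refine mul_le_mul_of_nonneg_left (hlr.trans ?_) (by positivity)
    exact mul_le_mul_of_nonneg_left htop (by norm_num)
  calc _ ≤ A * δ * (L : ℝ) ^ (k + 1) + (2 * A + Bc) * (4 / 3 * (17 * (((d : ℝ) + 1) * ((d : ℝ) + 4)) * (((L : ℝ) ^ (k + 1)) ^ 2 * x))) := add_le_add h1 h2
    _ = _ := by rw [hA, hB]; ring

/-! ## §2 The straight datum of the cut-off gauged slice element, closed form -/

section Closed

variable [Nonempty n] {L : ℕ} (hL : 2 ≤ L) (k : ℕ) {W : Site d → Fin d → (Matrix n n ℂ)ˣ} {x : ℝ}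
  (hWu : IsUnitaryCfg W) (hx : 0 ≤ x) (hs : LevelSmall d L k x) (hWx : SmallField W x)
  {u : Site d → (Matrix n n ℂ)ˣ} (hu : ∀ y, u y ∈ unitaryUnits (Matrix n n ℂ))

include hL hWu hx hs hWx hu in
/-- **THE CURVED HALF, CLOSED FORM**: if `QbarIter L (k+1) W Y zc κ = 0`, `‖Y‖ ≤ S` and `‖W^u − 1‖ ≤ δ` on the fine ball of `zc`, then
`‖linQIter L Y′ (k+1) zc κ‖ ≤ 2L^k·S·[(2d+4)L²·L^{k+1}·δ + (2(2d+4)L² + 8L + C_sup)·(4∕3)·17(d+1)(d+4)·(L^{k+1})²x]` (`Y′ = Ad_{u(·+e_μ)}Y`). [folklore] -/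
theorem norm_linQIter_gauged_le_closed (Y : Site d → Fin d → Matrix n n ℂ) (zc : Site d) (κ : Fin d) (hY0 : QbarIter L (k + 1) W Y zc κ = 0)
    {S δ : ℝ} (hS0 : 0 ≤ S) (hS : ∀ y μ, ‖Y y μ‖ ≤ S) (hδ0 : 0 ≤ δ)
    (hδ : ∀ (x' : Site d) (μ : Fin d), l1 (x' - ((L : ℤ) ^ (k + 1)) • zc) ≤ nbRad d L * ∑ i ∈ Finset.range (k + 1), L ^ i →
      ‖((gaugeAct u W x' μ : (Matrix n n ℂ)ˣ) : Matrix n n ℂ) - 1‖ ≤ δ) :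
    ‖linQIter L (fun y μ => Ad (u (y + e μ)) (Y y μ)) (k + 1) zc κ‖
      ≤ (L : ℝ) ^ k * (2 * S) * ((2 * (d : ℝ) + 4) * (L : ℝ) ^ 2 * ((L : ℝ) ^ (k + 1) * δ)
        + (2 * ((2 * (d : ℝ) + 4) * (L : ℝ) ^ 2) + (8 * (L : ℝ) + Csup d L)) * (4 / 3 * (17 * (((d : ℝ) + 1) * ((d : ℝ) + 4)) * (((L : ℝ) ^ (k + 1)) ^ 2 * x)))) := by
  have hL1 : 1 ≤ L := le_trans one_le_two hL
  have hW'u : IsUnitaryCfg (gaugeAct u W) := isUnitaryCfg_gaugeAct' hu hWu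
  have hW'x : SmallField (gaugeAct u W) x := smallField_gaugeAct hu hWx
  set Y' : Site d → Fin d → Matrix n n ℂ := fun y μ => Ad (u (y + e μ)) (Y y μ) with hY'
  have hS' : ∀ y μ, ‖Y' y μ‖ ≤ S := fun y μ => norm_dirGauge_le hu Y hS y μ
  -- covariance: the curved average of `Y′` at `W^u` vanishes at `(zc, κ)`
  have hcov : QbarIter L (k + 1) (gaugeAct u W) Y' zc κ = 0 := by
    have h := congrFun (congrFun (QbarIter_gaugeAct hL1 k hWu hx hs hWx hu Y) zc) κ
    rw [hY', h, hY0, Ad_zero]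
  -- the two families of the CLOSED near-identity tower at `W^u`
  have ha : ∀ (i m : ℕ), i + m = k → ∀ (y : Site d) (μ : Fin d),
      l1 (y - ((L : ℤ) ^ (m + 1)) • zc) ≤ nbRad d L * ∑ i ∈ Finset.range (m + 1), L ^ i →
      ‖((AveragingDeficitMultiLevelPrep.cavgIter L i (gaugeAct u W) y μ : (Matrix n n ℂ)ˣ) : Matrix n n ℂ) - 1‖
        ≤ (L : ℝ) ^ i * δ + 2 * loopRad d L ((prop1Radius d L)^[i] x) :=
    fun i m him y μ hy => norm_cavgIter_sub_one_le_closed hL hW'u hx hs hW'x zc hδ i (m + 1) (by omega) y μ hy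
  have hb : ∀ (i m : ℕ), i + m = k → ∀ (y : Site d) (μ : Fin d),
      l1 (y - ((L : ℤ) ^ (m + 1)) • zc) ≤ nbRad d L * ∑ i ∈ Finset.range (m + 1), L ^ i →
      ‖QbarIter L i (gaugeAct u W) Y' y μ‖ ≤ (L : ℝ) ^ i * (2 * S) := by
    intro i m him y μ hy
    have h := norm_QbarIter_le_two_mul hL k hW'u hx hs hW'x Y' zc hS0 (fun x' μ' _ => hS' x' μ') i (m + 1) (by omega) y μ hy
    linarith
  have hc : ∀ (y : Site d) (μ : Fin d), l1 (y - ((L : ℤ) ^ (k + 1)) • zc) ≤ nbRad d L * ∑ i ∈ Finset.range (k + 1), L ^ i →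
      ‖Y' y μ - Y' y μ‖ ≤ 0 := fun y μ _ => by rw [sub_self, norm_zero]
  have htower := norm_QbarIter_sub_linQIter_le hL1 k hW'u hx hs hW'x Y' Y' zc κ
    (ŝ := 2 * S) (e := 0) (fun i => (L : ℝ) ^ i * δ + 2 * loopRad d L ((prop1Radius d L)^[i] x))
    (fun i m him y μ hy => ha i m him y μ hy) hb hc
  rw [hcov, zero_sub, norm_neg, mul_zero, zero_add] at htower
  refine htower.trans (mul_le_mul_of_nonneg_left (sum_rho_le_of_delta (d := d) hL k hx hs hδ0) (by positivity))

include hL hWu hx hs hWx hu in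
/-- **THE STRAIGHT DATUM OF THE CUT-OFF GAUGED SLICE ELEMENT, CLOSED FORM** (`M = L^{k+1}`, `Y′ = Ad_{u(·+e_μ)}Y`): if `QbarIter L (k+1) W Y zc κ = 0`, `‖Y‖ ≤ S`, `|χ| ≤ 1`, `χ` is
`g`-Lipschitz per sup-unit step, and `‖W^u − 1‖ ≤ δ` on the fine ball of `zc`, then
`‖QbarIter L (k+1) flat (χ•Y′) zc κ‖ ≤ M·(2(M−1)·g·S) + 2L^k·S·[(2d+4)L²·M·δ + (2(2d+4)L² + 8L + C_sup)·(4∕3)·17(d+1)(d+4)·M²x]`. [folklore] -/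
theorem straight_datum_closed (Y : Site d → Fin d → Matrix n n ℂ) (χ : Site d → ℝ) (zc : Site d) (κ : Fin d)
    (hY0 : QbarIter L (k + 1) W Y zc κ = 0) {S g δ : ℝ} (hS0 : 0 ≤ S) (hS : ∀ y μ, ‖Y y μ‖ ≤ S)
    (hχ1 : ∀ y, |χ y| ≤ 1) (hstep : ∀ x₁ x₂ : Site d, (∀ j, |x₂ j - x₁ j| ≤ 1) → |χ x₂ - χ x₁| ≤ g) (hδ0 : 0 ≤ δ)
    (hδ : ∀ (x' : Site d) (μ : Fin d), l1 (x' - ((L : ℤ) ^ (k + 1)) • zc) ≤ nbRad d L * ∑ i ∈ Finset.range (k + 1), L ^ i →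
      ‖((gaugeAct u W x' μ : (Matrix n n ℂ)ˣ) : Matrix n n ℂ) - 1‖ ≤ δ) :
    ‖QbarIter L (k + 1) (flat (d := d) (n := n)) (fun y μ => χ y • Ad (u (y + e μ)) (Y y μ)) zc κ‖
      ≤ ((L ^ (k + 1) : ℕ) : ℝ) * ((((2 * (L ^ (k + 1) - 1) : ℕ)) : ℝ) * g * S)
        + (L : ℝ) ^ k * (2 * S) * ((2 * (d : ℝ) + 4) * (L : ℝ) ^ 2 * ((L : ℝ) ^ (k + 1) * δ)
          + (2 * ((2 * (d : ℝ) + 4) * (L : ℝ) ^ 2) + (8 * (L : ℝ) + Csup d L)) * (4 / 3 * (17 * (((d : ℝ) + 1) * ((d : ℝ) + 4)) * (((L : ℝ) ^ (k + 1)) ^ 2 * x)))) := by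
  have hL1 : 1 ≤ L := le_trans one_le_two hL
  have hM : 1 ≤ L ^ (k + 1) := Nat.one_le_pow _ _ hL1
  set Y' : Site d → Fin d → Matrix n n ℂ := fun y μ => Ad (u (y + e μ)) (Y y μ) with hY'
  have hS' : ∀ y μ, ‖Y' y μ‖ ≤ S := fun y μ => norm_dirGauge_le hu Y hS y μ
  set t : ℝ := χ (((L ^ (k + 1) : ℕ) : ℤ) • zc) with ht
  have hω := fun x' h1 h2 h3 => osc_region_of_supStep χ hstep hM zc κ x' h1 h2 h3
  have hcomm := cutoff_commutator_flat hL1 k χ t Y' zc κ hS' (ω := (((2 * (L ^ (k + 1) - 1) : ℕ)) : ℝ) * g)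
    (fun x' h1 h2 h3 => by
      have := hω x' h1 h2 h3
      push_cast at this h1 h2 h3 ⊢
      exact this)
  have hcurv := norm_linQIter_gauged_le_closed hL k hWu hx hs hWx hu Y zc κ hY0 hS0 hS hδ0 hδ
  rw [linQIter_eq_QbarIter_flat hL1] at hcurv
  have e1 : QbarIter L (k + 1) (flat (d := d) (n := n)) (fun y μ => χ y • Y' y μ) zc κ
      = (QbarIter L (k + 1) (flat (d := d) (n := n)) (fun y μ => χ y • Y' y μ) zc κ - t • QbarIter L (k + 1) (flat (d := d) (n := n)) Y' zc κ)
        + t • QbarIter L (k + 1) (flat (d := d) (n := n)) Y' zc κ := by rw [sub_add_cancel]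
  rw [e1]
  calc ‖QbarIter L (k + 1) flat (fun y μ => χ y • Y' y μ) zc κ - t • QbarIter L (k + 1) flat Y' zc κ + t • QbarIter L (k + 1) flat Y' zc κ‖
      ≤ ‖QbarIter L (k + 1) flat (fun y μ => χ y • Y' y μ) zc κ - t • QbarIter L (k + 1) flat Y' zc κ‖ + ‖t • QbarIter L (k + 1) flat Y' zc κ‖ := norm_add_le _ _
    _ ≤ ((L ^ (k + 1) : ℕ) : ℝ) * (((((2 * (L ^ (k + 1) - 1) : ℕ)) : ℝ) * g) * S) + 1 * ‖QbarIter L (k + 1) (flat (d := d) (n := n)) Y' zc κ‖ := by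
        refine add_le_add hcomm ?_
        rw [norm_smul, Real.norm_eq_abs]
        exact mul_le_mul_of_nonneg_right (hχ1 _) (norm_nonneg _)
    _ ≤ _ := by rw [one_mul, ← mul_assoc]; exact add_le_add le_rfl hcurv

omit [Nonempty n] in
include hL in
/-- **OFF THE SUPPORT**: if `χ` vanishes on the straight-average region of `(zc, κ)` then the straight datum of `χ•F` vanishes there, for ANY `F`. [folklore] -/
theorem straight_datum_off_support (F : Site d → Fin d → Matrix n n ℂ) (χ : Site d → ℝ) (zc : Site d) (κ : Fin d) {S : ℝ} (hS : ∀ y μ, ‖F y μ‖ ≤ S)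
    (hχ0 : ∀ x' : Site d, (((L ^ (k + 1) : ℕ) : ℤ) • zc) ≤ x' → (∀ i, i ≠ κ → x' i ≤ ((((L ^ (k + 1) : ℕ) : ℤ) • zc) i) + (((L ^ (k + 1) : ℕ) : ℤ) - 1)) →
      x' κ ≤ ((((L ^ (k + 1) : ℕ) : ℤ) • zc) κ) + 2 * (((L ^ (k + 1) : ℕ) : ℤ) - 1) → χ x' = 0) :
    QbarIter L (k + 1) (flat (d := d) (n := n)) (fun y μ => χ y • F y μ) zc κ = 0 := by
  have h := local_straight_datum_letter_off_support hL k F χ zc κ (S := S) (ω := 0) hS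
    (fun x' h1 h2 h3 => by rw [hχ0 x' h1 h2 h3, abs_zero])
  rw [zero_mul, mul_zero] at h
  exact norm_le_zero_iff.mp h

end Closed

end

end Summit.QuantumFields.BalabanUV.T4Continuum.NE7CurvedSupLetterPrep
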